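import Literature.Analysis.DeBrangesSpaces.BurnolSonineFunctionalEquation
import Literature.Analysis.DeBrangesSpaces.BurnolXPairingKernelDerivatives
import HarnessLib

/-!
# Burnol 2001 (CRAS 333), §1: the pairing identity `(f, X^λ_{w,k}] = (d/dw)^k(γ₊(w)f̂(1−w))` on
`Re w ≤ 1/2`, printed form

For `f ∈ K_{λ,λ}` with entire Mellin continuation `G` and compensated pairing function `P` in the
faithful sense (`IsXPairingFnC G P`: `P` entire, `P(v) = γ₊(v)G(1−v)` on `Re v > 0`), `P` IS the
entire continuation `G_{𝓕f} = ∫_λ^∞ f(u)C_λ(u,·)du` of `(𝓕₊f)^` (eq. (1.1),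
`BurnolSonineFunctionalEquation.lean`), hence `xPairingR G P w k = ∫_λ^∞ f(u) ∂_w^k C_λ(u,w) du`
on `Re w ≤ 1/2` (`BurnolXPairingKernelDerivatives.lean`): Burnol's
"`(f, X^λ_{w,k}] = (d^k/d^kw)(γ₊(w) f̂(1−w))`", `X^λ_{w,k}(t) = 𝟙_{t≥λ}(d^k/d^kw)C_λ(t,w)` (TeX l.393–400).
RH-FREE.

## References
* [Burnol2001CRAS] J.-F. Burnol, C. R. Acad. Sci. Paris 333 (2001) 201–206, §1 (TeX l.393–403).
-/

open MeasureTheory Set Filter Complex Metric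
open scoped Real Topology ENNReal FourierTransform

open Literature.NumberTheory.ConnesConsani2021 (soninSpace)
open Literature.Analysis.DeBrangesSpaces.SonineMellin (cosKernel sonineMellinExt
  differentiable_sonineMellinExt sonineMellinExt_eq_mellin)

namespace Literature.Analysis.DeBrangesSpaces

namespace Burnol2001

/-! ## C. The printed pairing identity on `Re w ≤ 1/2` -/

/-- For `f ∈ K_{λ,λ}` with entire Mellin continuation `G`, a compensated pairing function `P` in the
faithful sense (`IsXPairingFnC G P`) IS `G_{𝓕f} = sonineMellinExt λ λ f` (both agree with
`γ₊(v)G(1−v)` on `Re v > 0`, eq. (1.1)). [cite: Burnol2001CRAS, §1 (TeX l.398–403)] -/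
theorem IsXPairingFnC.eq_sonineMellinExt {lam : ℝ} (hlam : 0 < lam) {f : Lp ℂ 2 (volume : Measure ℝ)}
    (hf : f ∈ soninSpace lam lam) {G P : ℂ → ℂ} (hG : HasEntireMellin f G) (hP : IsXPairingFnC G P) :
    P = sonineMellinExt lam lam (f : ℝ → ℂ) := by
  obtain ⟨Q, hQd, hQ⟩ := exists_compensated_pairing_fn hlam hf hG
  -- `Q = sonineMellinExt λ λ f` is how the witness was built; we only use its defining property:
  -- both `P` and `sonineMellinExt λ λ f` agree with `γ₊(v)G(1−v)` on `Re v > 0`.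
  obtain ⟨hFmem, hFF⟩ := fourier_mem_soninSpace_swap hf
  obtain ⟨heven, hfa, hFb⟩ := hf
  have hGeq : G = sonineMellinExt lam lam ((𝓕 f : Lp ℂ 2 (volume : Measure ℝ)) : ℝ → ℂ) := by
    have hW : IsOpen {w : ℂ | w.re < 1 / 2} := isOpen_lt Complex.continuous_re continuous_const
    have hev : G =ᶠ[𝓝 (0 : ℂ)] sonineMellinExt lam lam ((𝓕 f : Lp ℂ 2 (volume : Measure ℝ)) : ℝ → ℂ) := by
      filter_upwards [hW.mem_nhds (by norm_num : (0 : ℂ) ∈ {w : ℂ | w.re < 1 / 2})] with z hz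
      rw [hG.2 z hz, sonineMellinExt_eq_mellin hlam hlam f heven hfa hFb hz]
    have h1 : AnalyticOnNhd ℂ G univ := hG.1.differentiableOn.analyticOnNhd isOpen_univ
    have h2 : AnalyticOnNhd ℂ (sonineMellinExt lam lam ((𝓕 f : Lp ℂ 2 (volume : Measure ℝ)) : ℝ → ℂ))
        univ := (differentiable_sonineMellinExt hlam hlam _).differentiableOn.analyticOnNhd isOpen_univ
    exact funext fun z ↦
      h1.eqOn_of_preconnected_of_eventuallyEq h2 isPreconnected_univ (mem_univ 0) hev (mem_univ z)
  set U : Set ℂ := {v : ℂ | 0 < v.re} with hU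
  have hUo : IsOpen U := isOpen_lt continuous_const Complex.continuous_re
  have h1 : AnalyticOnNhd ℂ P univ := hP.1.differentiableOn.analyticOnNhd isOpen_univ
  have h2 : AnalyticOnNhd ℂ (sonineMellinExt lam lam (f : ℝ → ℂ)) univ :=
    (differentiable_sonineMellinExt hlam hlam f).differentiableOn.analyticOnNhd isOpen_univ
  have hev : P =ᶠ[𝓝 (1 : ℂ)] sonineMellinExt lam lam (f : ℝ → ℂ) := by
    filter_upwards [hUo.mem_nhds (by simp [hU] : (1 : ℂ) ∈ U)] with v hv
    have k1 := sonineMellinExt_fourier_eq_gammaPlus_mul hlam hlam hFmem hv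
    rw [hFF] at k1
    rw [hP.2 v hv, hGeq, k1]
  exact funext fun z ↦
    h1.eqOn_of_preconnected_of_eventuallyEq h2 isPreconnected_univ (mem_univ 1) hev (mem_univ z)

/-- **The printed pairing identity on the branch `Re w ≤ 1/2`**: for `f ∈ K_{λ,λ}`,
`xPairingR G P w k = ∫_λ^∞ f(u) (d^k/d^kw)C_λ(u,w) du = (f, X^λ_{w,k}]`, `X^λ_{w,k}(t) =
𝟙_{t≥λ}(d^k/d^kw)C_λ(t,w)`. [cite: Burnol2001CRAS, §1 (TeX l.393–400)] -/
theorem xPairingR_eq_setIntegral_of_re_le {lam : ℝ} (hlam : 0 < lam) {f : Lp ℂ 2 (volume : Measure ℝ)}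
    (hf : f ∈ soninSpace lam lam) {G P : ℂ → ℂ} (hG : HasEntireMellin f G) (hP : IsXPairingFnC G P)
    (k : ℕ) {w : ℂ} (hw : w.re ≤ 1 / 2) :
    xPairingR G P w k = ∫ u in Ioi lam, (f : ℝ → ℂ) u * iteratedDeriv k (cosKernel lam u) w := by
  rw [xPairingR, if_neg (not_lt.2 hw), hP.eq_sonineMellinExt hlam hf hG,
    iteratedDeriv_sonineMellinExt hlam hlam f k w]

end Burnol2001

end Literature.Analysis.DeBrangesSpaces
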